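import Literature.MathematicalPhysics.QuantumManyBody.SwapPurity
import Mathlib.MeasureTheory.Integral.Marginal
import Mathlib.MeasureTheory.Group.LIntegral
import HarnessLib

/-!
# Route `BECHeatBathGap`, crux `SquareSummableInfluence` (stmt-AtomisticToContinuum-14368), line `registered`:
# PAIR-INFLUENCE REDUCTION — the influence sum from a blind approximation with a profile and a
# one-particle conditional-density bound

Supports (does not close) stmt-AtomisticToContinuum-14368 (lead c3). The two-layer plan of the route
(`SquareSummableInfluence ⇐ PairInfluenceReduction → DressedPairTail`) made into a theorem of measure theory,
`influence_le_of_blindApprox`: let `Θ` be an `N`-body amplitude (the bath), `Ψ` an `(N+1)`-body amplitude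
(`Z 0 = y` the inserted particle, `tail Z` the bath), and suppose

* (blind approximation with a profile) for each bath label `i` there are a candidate predictor `b_i` and a
  BLIND envelope `a_i ≥ 0` (independent of `x_i = Z (succ i)`) and a common squared profile `D ≥ 0` on `ℝ³`
  with `|Ψ(Z) − b_i(Z) Θ(tail Z)|² ≤ a_i(Z) · D(x_i − y) · |Θ(tail Z)|²` pointwise — for the pair-product
  insertion `Ψ = Θ(tail) ∏_j f(y − x_j)` this holds with `b_i = ∏_{j≠i} f`, `a_i = 1`, `D = (1 − f)²`, and for
  the true ground-state pair it is the statement that resampling ONE bath particle changes the insertion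
  amplitude `Ψ₀/Θ₀` by a dressed pair factor `u_eff(y − x_i)` (route card A2);
* (one-particle conditional-density bound, "no bath particle is pinned by the others") for each `i` and every
  configuration `X`, `|Θ(X)|² ≤ C ∫_{Λ_L} |Θ(X with x_i ↦ x)|² dx` — `C = c/L³` says the conditional law of
  `x_i` given the other bath particles has density `≤ c/|Λ|` (free Dirichlet ground state: `c = 8`; Jastrow:
  `c = 1/(1 − ρ‖1 − f²‖₁)`);

then `∑_i ∫_{Λ^{N+1}} |Ψ − b_i Θ(tail)|² ≤ C ‖D‖₁ ∑_i ∫_{Λ^{N+1}} a_i |Θ(tail)|²`. With `C = c/L³`, `‖D‖₁ = ‖1 − f_eff‖₂²`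
and envelope budget `∑_i ∫ a_i|Θ(tail)|² ≤ N` this is the card's `I ≲ c ρ ‖1 − f_eff‖₂²`: A2 holds for the true
ground states as soon as they have (i) a dressed, square-integrable one-bath-particle influence profile with
`ρ‖1 − f_eff‖₂² → 0` and (ii) delocalised one-particle conditional laws, uniformly in `N`. Proof: compare the
two integrands fibrewise in the coordinate `x_i` (Mathlib's `lmarginal` over the box product measure): on each
fibre the envelope is constant, the density bound turns `|Θ|²` into `C ×` (the fibre mass of `|Θ|²`), and the
profile integrates to at most `‖D‖₁` by translation invariance.
-/

noncomputable section

open MeasureTheory Filter Function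
open scoped ENNReal NNReal Topology

namespace Summit.AtomisticToContinuum.BoseEinsteinCondensation.Theorems.SquareSummableInfluence

open Literature.MathematicalPhysics.QuantumManyBody.BoseGas

/-! ### Bookkeeping: tails of updates, the box product measure -/

/-- Removing the inserted particle commutes with resampling a bath particle:
`tail (Z with Z (succ i) ↦ x) = (tail Z) with i ↦ x`. [folklore] -/
theorem vecTail_update_succ {n : ℕ} (Z : Config (n + 1)) (i : Fin n) (x : Space) :
    Matrix.vecTail (update Z (Fin.succ i) x) = update (Matrix.vecTail Z) i x := by
  funext j
  by_cases h : j = i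
  · subst h
    simp [Matrix.vecTail]
  · have h' : Fin.succ j ≠ Fin.succ i := fun e => h (Fin.succ_injective _ e)
    simp [Matrix.vecTail, update_of_ne h, update_of_ne h']

/-- Lebesgue measure restricted to the `n`-particle box is the product of the one-particle box measures.
[folklore] -/
theorem volume_restrict_boxN_eq_pi (n : ℕ) (L : ℝ) :
    (volume : Measure (Config n)).restrict (boxN n L) =
      Measure.pi fun _ : Fin n => (volume : Measure Space).restrict (box L) := by
  have h : boxN n L = Set.univ.pi fun _ : Fin n => box L := by
    ext X
    simp [boxN]
  rw [h, volume_pi, Measure.restrict_pi_pi]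

/-! ### The fibrewise comparison -/

/-- **Fibre bound.** On the fibre of the bath coordinate `x_i` through `Z` (integrating `x_i` over the box), the
squared defect `|Ψ − b Θ(tail)|²` is at most `C ‖D‖₁` times the fibre integral of `a |Θ(tail)|²`, given the
pointwise blind-approximation bound with envelope `a` (constant on the fibre) and profile `D`, and the
conditional-density bound for `Θ` in the coordinate `i`. [folklore] -/
theorem fibre_influence_le {N : ℕ} (L : ℝ) (C : ℝ≥0∞) {D : Space → ℝ≥0∞} {Θ : Config N → ℂ}
    {Ψ b : Config (N + 1) → ℂ} {a : Config (N + 1) → ℝ≥0∞} (i : Fin N)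
    (hD : Measurable D) (hΘ : Measurable Θ)
    (ha : ∀ Z x, a (update Z (Fin.succ i) x) = a Z)
    (hB : ∀ Z, (‖Ψ Z - b Z * Θ (Matrix.vecTail Z)‖₊ : ℝ≥0∞) ^ 2 ≤
      a Z * D (Z (Fin.succ i) - Z 0) * (‖Θ (Matrix.vecTail Z)‖₊ : ℝ≥0∞) ^ 2)
    (hU : ∀ X : Config N, (‖Θ X‖₊ : ℝ≥0∞) ^ 2 ≤
      C * ∫⁻ x in box L, (‖Θ (update X i x)‖₊ : ℝ≥0∞) ^ 2)
    (Z : Config (N + 1)) :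
    ∫⁻ x in box L, (‖Ψ (update Z (Fin.succ i) x) -
        b (update Z (Fin.succ i) x) * Θ (Matrix.vecTail (update Z (Fin.succ i) x))‖₊ : ℝ≥0∞) ^ 2 ≤
      (C * ∫⁻ x, D x) * ∫⁻ x in box L,
        a (update Z (Fin.succ i) x) * (‖Θ (Matrix.vecTail (update Z (Fin.succ i) x))‖₊ : ℝ≥0∞) ^ 2 := by
  -- the fibre mass of `|Θ|²` in the coordinate `i` through `tail Z`
  set m : ℝ≥0∞ := ∫⁻ x in box L, (‖Θ (update (Matrix.vecTail Z) i x)‖₊ : ℝ≥0∞) ^ 2 with hm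
  have hmeas : Measurable fun x : Space => (‖Θ (update (Matrix.vecTail Z) i x)‖₊ : ℝ≥0∞) ^ 2 :=
    (hΘ.comp (measurable_update _)).nnnorm.coe_nnreal_ennreal.pow_const 2
  have h0 : ∀ x : Space, update Z (Fin.succ i) x 0 = Z 0 := fun x =>
    update_of_ne (Fin.succ_ne_zero i).symm _ _
  -- right-hand side: the envelope is constant on the fibre
  have hR : ∫⁻ x in box L, a (update Z (Fin.succ i) x) *
      (‖Θ (Matrix.vecTail (update Z (Fin.succ i) x))‖₊ : ℝ≥0∞) ^ 2 = a Z * m := by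
    simp only [ha, vecTail_update_succ]
    rw [lintegral_const_mul _ hmeas]
  rw [hR]
  -- the profile integrates to at most `‖D‖₁` over the box fibre
  have hDm : Measurable fun x : Space => D (x - Z 0) := hD.comp (measurable_id.sub_const _)
  have hDint : ∫⁻ x in box L, D (x - Z 0) ≤ ∫⁻ x, D x :=
    (setLIntegral_le_lintegral _ _).trans_eq (lintegral_sub_right_eq_self D (Z 0))
  calc ∫⁻ x in box L, (‖Ψ (update Z (Fin.succ i) x) -
          b (update Z (Fin.succ i) x) * Θ (Matrix.vecTail (update Z (Fin.succ i) x))‖₊ : ℝ≥0∞) ^ 2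
      ≤ ∫⁻ x in box L, a Z * D (x - Z 0) * (‖Θ (update (Matrix.vecTail Z) i x)‖₊ : ℝ≥0∞) ^ 2 := by
        refine lintegral_mono fun x => ?_
        have h := hB (update Z (Fin.succ i) x)
        rw [ha, update_self, h0, vecTail_update_succ] at h
        rwa [vecTail_update_succ]
    _ ≤ ∫⁻ x in box L, a Z * D (x - Z 0) * (C * m) := by
        refine lintegral_mono fun x => ?_
        gcongr
        have h := hU (update (Matrix.vecTail Z) i x)
        simp only [update_idem] at h
        exact h
    _ = a Z * (C * m) * ∫⁻ x in box L, D (x - Z 0) := by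
        rw [← lintegral_const_mul _ hDm]
        refine lintegral_congr fun x => ?_
        ring
    _ ≤ a Z * (C * m) * ∫⁻ x, D x := by
        gcongr
    _ = C * (∫⁻ x, D x) * (a Z * m) := by
        ring

/-! ### The reduction -/

/-- **Pair-influence reduction.** Let `Θ : Λ^N → ℂ` (bath) and `Ψ : Λ^{N+1} → ℂ` (bath plus the inserted particle
`Z 0`) be measurable, and for each bath label `i` let `b_i` (measurable) be a candidate predictor, `a_i ≥ 0` a
measurable envelope BLIND to `x_i = Z (succ i)`, and `D ≥ 0` a measurable squared profile on `ℝ³` with the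
pointwise blind-approximation bound `|Ψ(Z) − b_i(Z)Θ(tail Z)|² ≤ a_i(Z) D(x_i − y) |Θ(tail Z)|²`; suppose the
one-particle conditional-density bound `|Θ(X)|² ≤ C ∫_{Λ_L} |Θ(X with x_i ↦ x)|² dx` for every `i` and `X`.
Then `∑_i ∫_{Λ_L^{N+1}} |Ψ − b_i Θ(tail)|² ≤ C ‖D‖₁ ∑_i ∫_{Λ_L^{N+1}} a_i |Θ(tail)|²` — with `C = c/L³`,
`‖D‖₁ = ‖1 − f_eff‖₂²` and envelope budget `≤ N` this is `I ≤ c ρ ‖1 − f_eff‖₂²` (route card A2).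
[cite: LiebSeiringerSolovejYngvason2005, §2.1 (2.11)–(2.12)] [cite: Reatto1969, §II] -/
theorem influence_le_of_blindApprox :
    ∀ (N : ℕ) (L : ℝ) (C : ℝ≥0∞) (D : Space → ℝ≥0∞) (Θ : Config N → ℂ) (Ψ : Config (N + 1) → ℂ)
      (b : Fin N → Config (N + 1) → ℂ) (a : Fin N → Config (N + 1) → ℝ≥0∞),
      Measurable D → Measurable Θ → Measurable Ψ → (∀ i, Measurable (b i)) → (∀ i, Measurable (a i)) →
      (∀ i Z x, a i (Function.update Z (Fin.succ i) x) = a i Z) →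
      (∀ i Z, (‖Ψ Z - b i Z * Θ (Matrix.vecTail Z)‖₊ : ℝ≥0∞) ^ 2 ≤
        a i Z * D (Z (Fin.succ i) - Z 0) * (‖Θ (Matrix.vecTail Z)‖₊ : ℝ≥0∞) ^ 2) →
      (∀ (i : Fin N) (X : Config N), (‖Θ X‖₊ : ℝ≥0∞) ^ 2 ≤
        C * ∫⁻ x in box L, (‖Θ (Function.update X i x)‖₊ : ℝ≥0∞) ^ 2) →
      (∑ i : Fin N, ∫⁻ Z in boxN (N + 1) L,
          (‖Ψ Z - b i Z * Θ (Matrix.vecTail Z)‖₊ : ℝ≥0∞) ^ 2) ≤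
        C * (∫⁻ x, D x) * ∑ i : Fin N, ∫⁻ Z in boxN (N + 1) L,
          a i Z * (‖Θ (Matrix.vecTail Z)‖₊ : ℝ≥0∞) ^ 2 := by
  intro N L C D Θ Ψ b a hD hΘ hΨ hb ha hau hB hU
  rw [Finset.mul_sum]
  refine Finset.sum_le_sum fun i _ => ?_
  -- the two integrands and their measurability
  have hΘt : Measurable fun Z : Config (N + 1) => Θ (Matrix.vecTail Z) := hΘ.comp measurable_vecTail
  have hf : Measurable fun Z : Config (N + 1) =>
      (‖Ψ Z - b i Z * Θ (Matrix.vecTail Z)‖₊ : ℝ≥0∞) ^ 2 :=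
    (hΨ.sub ((hb i).mul hΘt)).nnnorm.coe_nnreal_ennreal.pow_const 2
  have hg0 : Measurable fun Z : Config (N + 1) => a i Z * (‖Θ (Matrix.vecTail Z)‖₊ : ℝ≥0∞) ^ 2 :=
    (ha i).mul (hΘt.nnnorm.coe_nnreal_ennreal.pow_const 2)
  have hg : Measurable fun Z : Config (N + 1) =>
      (C * ∫⁻ x, D x) * (a i Z * (‖Θ (Matrix.vecTail Z)‖₊ : ℝ≥0∞) ^ 2) := hg0.const_mul _
  -- pass to the box product measure and compare fibrewise in the coordinate `succ i`
  rw [← lintegral_const_mul _ hg0, volume_restrict_boxN_eq_pi]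
  refine lintegral_le_of_lmarginal_le (μ := fun _ : Fin (N + 1) => (volume : Measure Space).restrict (box L))
    {Fin.succ i} hf hg fun Z => ?_
  simp only [lmarginal_singleton]
  have hgx : Measurable fun x : Space => a i (update Z (Fin.succ i) x) *
      (‖Θ (Matrix.vecTail (update Z (Fin.succ i) x))‖₊ : ℝ≥0∞) ^ 2 :=
    hg0.comp (measurable_update (a := Fin.succ i) Z)
  rw [lintegral_const_mul _ hgx]
  exact fibre_influence_le L C i hD hΘ (hau i) (hB i) (hU i) Z

end Summit.AtomisticToContinuum.BoseEinsteinCondensation.Theorems.SquareSummableInfluence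

end
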